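/-
Copyright (c) 2026 the pub-hodgecm-mathlib formalisation cell (harness21).  Prover seat hodgecm-mathlib-K2E3-p17 (g6), Track B «K2-LIT» ∕ h413
(`stmt-HodgeConjecture-24833`), line `K2_E3_EllipticInputs`, unit U12 §L, Richardson road for (LBGL-ge3) at `N = 3` (road owner K2E3-p11 (g4)),
brick (F-J) = (S-B♭)_Lie, FILE E2 «THE HAAR-EXACT DEPTH CHART AT A REGULAR DIAGONAL POINT OF 𝔤𝔩₃(F)».  2026-09-04.
-/
import Summits.HodgeConjecture.HodgeConjecture.Theorems.K2E3GL3OrbitChartDeriv                -- ★ (this seat, E1): `hasStrictFDerivAt_orbitChart`, `orbitChart_zero`, §1 algebra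
import Summits.HodgeConjecture.HodgeConjecture.Theorems.F0P3cStCharTSStrictDerivNewton     -- ★ p851993 (F0P2-p01): `exists_depth_chart` (Schikhof §27: Haar-exact Newton charts)
import Summits.HodgeConjecture.HodgeConjecture.Theorems.K2E3GLnMaximalParabolicDescent      -- ★ p857137 (K2E3-p11): `regular_of_isAddHaarMeasure`, `exists_continuousLinearEquiv_entries`, matrix LCS∕2nd-countability
import Summits.HodgeConjecture.HodgeConjecture.Theorems.K2E3GLnLieAdIntegralInvariant       -- ★ (K2E3-p12): integer boxes, `glInt` kit (re-exported for FILES G∕H)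
import Literature.NumberTheory.GaloisRepresentations.LocalFieldFiniteExtension              -- ★ R1 frame: `nontriviallyNormedField`, `norm_le_norm_iff_vle`, completeness, ultrametricity
import Literature.NumberTheory.Automorphic.LocalRingUnitModulusProduct                      -- ★ `UnitaryGroup.distribHaarChar_eq_normAbs`
import Literature.NumberTheory.Automorphic.LocalFieldHaarBalls                              -- ★ `primePowBall` kit, `exists_normAbs_eq_inv` (via TateLocalZetaShells)
import Literature.MeasureTheory.Group.LocalFieldGLnVolume                                  -- ★ boxes `M₃(𝔭^k)`: `isOpen∕isCompact_setOf_forall_mem_primePowBall`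
import HarnessLib

/-!
# K2_E3 road (h413), §L ∕ Richardson road at `N = 3`, brick (F-J) FILE E2: the Haar-exact depth chart `Ψ_t` at a regular diagonal point of `𝔤𝔩₃(F)`

Cell `pub/hodgecm-mathlib` (D-0151), Track B, seat K2E3-p17 (g6), deal (D60) = (F-J) (road owner K2E3-p11 (g4); census `K2/K2E3-p17/g6/CENSUS-SBflatLie-N3.K2E3-p17-g6.md`
§1 (iii), brick E).  `--supports stmt-HodgeConjecture-24833 --as helper`; THEOREMS ONLY (no definition ∕ instance ∕ notation ∕ named fact ∕ `sorry`); never imports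
`Cruxes/…/Lines`.  COUNT-NEUTRAL.

THE POINT.  With ★ E1 (`hasStrictFDerivAt_orbitChart`: the chart `Ψ_t(X) = Ad((1+X⁺)(1+X⁻))(t + X_d)` has strict derivative the entrywise scaling `e_t` at `0`), ★
`exists_depth_chart` (the ultrametric Newton chart of the road «HC-D», Schikhof §27) makes `Ψ_t` INJECTIVE on every deep box `Λ_k = M₃(𝔭^k)`, with image the compact
open `V_k(t) = t + e_t(Λ_k) ∋ t`, and HAAR-EXACT:
  `∫⁻_{Λ_k} h ∘ Ψ_t dμ𝔤 = ‖∏_{i,j} c_{ij}‖_F⁻¹ · ∫⁻_{V_k(t)} h dμ𝔤`,  `c_{ii} = 1`, `c_{ij} = d_j − d_i` (so `‖∏ c‖ = ‖D(t)‖_F`, the Weyl discriminant),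
the factor being the Haar character of `e_t` (★ `LocalFieldLinearJacobian` transported along the entry trivialisation; ★ `distribHaarChar_eq_normAbs`).  This is the
LOCAL WEYL INTEGRATION INPUT of the (F-J) head: FILES G∕H turn it into `ρ|_{V_k(t)} = c′·‖D‖^{-1∕2} μ𝔤|_{V_k(t)}` for `ρ(f) = ∫_K ∫_𝔟 f(Ad(k)b) db dk` and then into
`K2E3GL3BorelSliceDensity.exists_borelSliceDensity`.
* `addEquivAddHaarChar_scaling` — the Haar character of an entrywise scaling of `M₃(F)` is `‖∏ c_{ij}‖_F`;  `continuous_orbitChart`;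
* **`exists_depth_orbitChart`** — the export (injective ∕ image compact-open ∋ `t` ∕ the `∫⁻` identity), boxes spelled `{X | ∀ i j, X i j ∈ primePowBall F k}`
  (the statement is norm-free; the valuation norm and the elementwise sup norm live inside the proof — R1 frame).
[HarishChandra1999AdmissibleDistributions, Lemma 7.8, §7] [HarishChandra1970, Part V §4 Lemma 22] [Schikhof1984, §27 Lemma 27.4–Thm. 27.5] [WeilBNT1967, Ch. I §2]
HONEST LABEL: HC_CM is proved only modulo the 7 printed citations (2 remaining named inputs: hLiu418 = stmt-HodgeConjecture-24832, h413 = stmt-HodgeConjecture-24833)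
until rung 0 closes; count-neutral helper ((LBGL-ge3)∕(LBGL-3J) NOT ★ here).

## References
* [HarishChandra1999AdmissibleDistributions] Harish-Chandra (DeBacker–Sally), *Admissible Invariant Distributions on Reductive p-adic Groups* (1999), §7, Lemma 7.8.
* [HarishChandra1970] Harish-Chandra (van Dijk), *Harmonic Analysis on Reductive p-adic Groups*, LNM 162 (1970), Part V §4 Lemma 22.
* [Schikhof1984] W. H. Schikhof, *Ultrametric Calculus* (1984), §27 Lemma 27.4–Thm. 27.5.
* [WeilBNT1967] A. Weil, *Basic Number Theory* (1967), Ch. I §2.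
-/

set_option autoImplicit false
set_option linter.dupNamespace false

noncomputable section

open MeasureTheory Measure Filter Topology Set Matrix
open scoped MatrixGroups NNReal ENNReal Pointwise
open Literature.NumberTheory.Automorphic Literature.NumberTheory.Automorphic.LocalFieldHaar
open Literature.NumberTheory.GaloisRepresentations Literature.NumberTheory.GaloisRepresentations.IsNonarchimedeanLocalField
open Summit.HodgeConjecture.HodgeConjecture.Cruxes.H413.F0P3cStCharTSStrictDerivNewton
open Summit.HodgeConjecture.HodgeConjecture.Cruxes.H413.K2E3GLnMaximalParabolicDescent
open Summit.HodgeConjecture.HodgeConjecture.Cruxes.H413.K2E3GL3OrbitChartDeriv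

namespace Summit.HodgeConjecture.HodgeConjecture.Cruxes.H413.K2E3GL3RegularDiagonalOrbitChart

/-! ## The local field: Haar character of the scaling, continuity of the chart, and THE DEPTH CHART at a regular diagonal point -/

section LocalField

variable {F : Type*} [Field F] [ValuativeRel F] [TopologicalSpace F] [IsNonarchimedeanLocalField F]
  [MeasurableSpace F] [BorelSpace F]
  [MeasurableSpace (Matrix (Fin 3) (Fin 3) F)] [BorelSpace (Matrix (Fin 3) (Fin 3) F)]

/-- **The Haar character of an entrywise scaling is `‖∏ c_{ij}‖_F`** (transport to `F^{3×3}` along the entry trivialisation ★ `exists_continuousLinearEquiv_entries`,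
★ `addEquivAddHaarChar_eq_prod_of_apply_eq_mul`, ★ `distribHaarChar_eq_normAbs`). [cite: WeilBNT1967, Ch. I §2] -/
theorem addEquivAddHaarChar_scaling [LocallyCompactSpace (Matrix (Fin 3) (Fin 3) F)] (c : Fin 3 → Fin 3 → F) (hc : ∀ i j, c i j ≠ 0)
    (e : Matrix (Fin 3) (Fin 3) F ≃L[F] Matrix (Fin 3) (Fin 3) F) (he : ∀ X i j, e X i j = c i j * X i j) :
    addEquivAddHaarChar e.toContinuousAddEquiv = normAbs F (∏ i, ∏ j, c i j) := by
  classical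
  haveI : T2Space F := (isLocalField F).toT2Space
  haveI : LocallyCompactSpace F := (isLocalField F).toLocallyCompactSpace
  haveI : SecondCountableTopology F := secondCountableTopology_localField F
  haveI : IsTopologicalRing F := inferInstance
  obtain ⟨E, hE⟩ := exists_continuousLinearEquiv_entries (F := F) (m := Fin 3) (n := Fin 3)
  set L : (Fin 3 × Fin 3 → F) ≃L[F] (Fin 3 × Fin 3 → F) := (E.symm.trans e).trans E with hL
  have hLx : ∀ x p, L x p = c p.1 p.2 * x p := by
    intro x p
    rw [hL, ContinuousLinearEquiv.trans_apply, ContinuousLinearEquiv.trans_apply, hE, he]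
    congr 1
    rw [← hE (E.symm x) p, ContinuousLinearEquiv.apply_symm_apply]
  have hsemi : ∀ X, E.toContinuousAddEquiv (e.toContinuousAddEquiv X) = L.toContinuousAddEquiv (E.toContinuousAddEquiv X) := by
    intro X
    change E (e X) = L (E X)
    rw [hL, ContinuousLinearEquiv.trans_apply, ContinuousLinearEquiv.trans_apply, ContinuousLinearEquiv.symm_apply_apply]
  rw [Literature.MeasureTheory.Group.addEquivAddHaarChar_eq_of_semiconj E.toContinuousAddEquiv e.toContinuousAddEquiv L.toContinuousAddEquiv hsemi,
    Literature.MeasureTheory.Group.addEquivAddHaarChar_eq_prod_of_apply_eq_mul L (fun p => Units.mk0 (c p.1 p.2) (hc p.1 p.2)) (fun x p => hLx x p),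
    ← Finset.univ_product_univ, Finset.prod_product]
  simp_rw [map_prod]
  refine Finset.prod_congr rfl fun i _ => Finset.prod_congr rfl fun j _ => ?_
  rw [UnitaryGroup.distribHaarChar_eq_normAbs, Units.val_mk0]

omit [MeasurableSpace F] [BorelSpace F] [MeasurableSpace (Matrix (Fin 3) (Fin 3) F)] [BorelSpace (Matrix (Fin 3) (Fin 3) F)] in
/-- The chart `Ψ_t` is continuous (a polynomial map of `M₃(F)`). [folklore] -/
theorem continuous_orbitChart (d : Fin 3 → F) :
    Continuous (fun X : Matrix (Fin 3) (Fin 3) F =>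
        (1 + !![0, X 0 1, X 0 2; 0, 0, X 1 2; 0, 0, 0]) * (1 + !![0, 0, 0; X 1 0, 0, 0; X 2 0, X 2 1, 0]) *
          (Matrix.diagonal d + Matrix.diagonal (fun i => X i i)) *
          ((1 - !![0, 0, 0; X 1 0, 0, 0; X 2 0, X 2 1, 0] + !![0, 0, 0; X 1 0, 0, 0; X 2 0, X 2 1, 0] * !![0, 0, 0; X 1 0, 0, 0; X 2 0, X 2 1, 0]) *
            (1 - !![0, X 0 1, X 0 2; 0, 0, X 1 2; 0, 0, 0] + !![0, X 0 1, X 0 2; 0, 0, X 1 2; 0, 0, 0] * !![0, X 0 1, X 0 2; 0, 0, X 1 2; 0, 0, 0]))) := by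
  haveI : IsTopologicalRing F := inferInstance
  have hU : Continuous fun X : Matrix (Fin 3) (Fin 3) F => (!![0, X 0 1, X 0 2; 0, 0, X 1 2; 0, 0, 0] : Matrix (Fin 3) (Fin 3) F) := by
    refine continuous_matrix fun i j => ?_
    fin_cases i <;> fin_cases j <;> simp <;> first | exact continuous_const | exact continuous_id.matrix_elem _ _
  have hL : Continuous fun X : Matrix (Fin 3) (Fin 3) F => (!![0, 0, 0; X 1 0, 0, 0; X 2 0, X 2 1, 0] : Matrix (Fin 3) (Fin 3) F) := by
    refine continuous_matrix fun i j => ?_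
    fin_cases i <;> fin_cases j <;> simp <;> first | exact continuous_const | exact continuous_id.matrix_elem _ _
  have hD : Continuous fun X : Matrix (Fin 3) (Fin 3) F => Matrix.diagonal fun i => X i i :=
    (continuous_pi fun i => continuous_id.matrix_elem i i).matrix_diagonal
  refine Continuous.fun_mul (Continuous.fun_mul (Continuous.fun_mul ?_ ?_) ?_) (Continuous.fun_mul ?_ ?_)
  · exact continuous_const.fun_add hU
  · exact continuous_const.fun_add hL
  · exact continuous_const.fun_add hD
  · exact (continuous_const.fun_sub hL).fun_add (hL.fun_mul hL)
  · exact (continuous_const.fun_sub hU).fun_add (hU.fun_mul hU)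


/-- **THE DEPTH CHART AT A REGULAR DIAGONAL POINT OF `𝔤𝔩₃(F)`.**  Let `t = diagonal d` with `d` injective, `μ𝔤` an additive Haar measure on `𝔤𝔩₃(F)`, and `Ψ = Ψ_t` the
orbit chart (`hΨ`).  There is a depth `k₀` such that for every `k ≥ k₀`, on the box `Λ_k = M₃(𝔭^k) = {X | ∀ i j, X i j ∈ 𝔭^k}`:
(a) `Ψ` is injective on `Λ_k`; (b) `V_k := Ψ '' Λ_k` is open and compact and contains `t`; (c) HAAR-EXACTNESS — for every measurable `h ≥ 0`,
`∫⁻_{Λ_k} h (Ψ X) dμ𝔤 = ‖∏_{i,j} c_{ij}‖_F⁻¹ · ∫⁻_{V_k} h dμ𝔤` with `c_{ii} = 1`, `c_{ij} = d_j − d_i` (so `‖∏ c‖ = ‖D(t)‖`).  Proof: ★ `exists_depth_chart` on ★ §2 (strict derivative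
`e_t`) for the ball filtration `Λ_j = closedBall 0 ‖ϖ‖^j` of the valuation norm (= the boxes `M₃(𝔭^j)`), then the Haar character of `e_t` (★ §3 `addEquivAddHaarChar_scaling`) and
translation invariance. [cite: Schikhof1984, §27 Lemma 27.4–Thm. 27.5] [cite: HarishChandra1970, Part V §4 Lemma 22] [cite: HarishChandra1999AdmissibleDistributions, Lemma 7.8] -/
theorem exists_depth_orbitChart (d : Fin 3 → F) (hd : ∀ i j, i ≠ j → d i ≠ d j)
    (μ𝔤 : Measure (Matrix (Fin 3) (Fin 3) F)) [μ𝔤.IsAddHaarMeasure]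
    (Ψ : Matrix (Fin 3) (Fin 3) F → Matrix (Fin 3) (Fin 3) F)
    (hΨ : Ψ = fun X : Matrix (Fin 3) (Fin 3) F =>
        (1 + !![0, X 0 1, X 0 2; 0, 0, X 1 2; 0, 0, 0]) * (1 + !![0, 0, 0; X 1 0, 0, 0; X 2 0, X 2 1, 0]) *
          (Matrix.diagonal d + Matrix.diagonal (fun i => X i i)) *
          ((1 - !![0, 0, 0; X 1 0, 0, 0; X 2 0, X 2 1, 0] + !![0, 0, 0; X 1 0, 0, 0; X 2 0, X 2 1, 0] * !![0, 0, 0; X 1 0, 0, 0; X 2 0, X 2 1, 0]) *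
            (1 - !![0, X 0 1, X 0 2; 0, 0, X 1 2; 0, 0, 0] + !![0, X 0 1, X 0 2; 0, 0, X 1 2; 0, 0, 0] * !![0, X 0 1, X 0 2; 0, 0, X 1 2; 0, 0, 0]))) :
    ∃ k₀ : ℕ, ∀ k : ℕ, k₀ ≤ k →
      Set.InjOn Ψ {X : Matrix (Fin 3) (Fin 3) F | ∀ i j, X i j ∈ primePowBall F k} ∧
      IsOpen (Ψ '' {X : Matrix (Fin 3) (Fin 3) F | ∀ i j, X i j ∈ primePowBall F k}) ∧
      IsCompact (Ψ '' {X : Matrix (Fin 3) (Fin 3) F | ∀ i j, X i j ∈ primePowBall F k}) ∧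
      Matrix.diagonal d ∈ Ψ '' {X : Matrix (Fin 3) (Fin 3) F | ∀ i j, X i j ∈ primePowBall F k} ∧
      (∀ h : Matrix (Fin 3) (Fin 3) F → ℝ≥0∞, Measurable h →
        ∫⁻ X in {X : Matrix (Fin 3) (Fin 3) F | ∀ i j, X i j ∈ primePowBall F k}, h (Ψ X) ∂μ𝔤 =
          ((normAbs F (∏ i : Fin 3, ∏ j : Fin 3, if i = j then (1 : F) else d j - d i))⁻¹ : ℝ≥0) *
            ∫⁻ Y in Ψ '' {X : Matrix (Fin 3) (Fin 3) F | ∀ i j, X i j ∈ primePowBall F k}, h Y ∂μ𝔤) := by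
  classical
  -- ===== R1 frame, inside the proof only =====
  letI : NontriviallyNormedField F := IsNonarchimedeanLocalField.nontriviallyNormedField F
  haveI : CompleteSpace F := IsNonarchimedeanLocalField.completeSpace_nontriviallyNormedField F
  haveI : IsUltrametricDist F := IsNonarchimedeanLocalField.isUltrametricDist_nontriviallyNormedField F
  haveI : ProperSpace F := ProperSpace.of_nontriviallyNormedField_of_weaklyLocallyCompactSpace F
  haveI : T2Space F := (isLocalField F).toT2Space
  haveI : SecondCountableTopology F := secondCountableTopology_localField F
  haveI : IsTopologicalRing F := inferInstance
  letI : NormedAddCommGroup (Matrix (Fin 3) (Fin 3) F) := Matrix.normedAddCommGroup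
  letI : NormedSpace F (Matrix (Fin 3) (Fin 3) F) := Matrix.normedSpace
  haveI : IsUltrametricDist (Matrix (Fin 3) (Fin 3) F) := inferInstanceAs (IsUltrametricDist (Fin 3 → Fin 3 → F))
  haveI : ProperSpace (Matrix (Fin 3) (Fin 3) F) := inferInstanceAs (ProperSpace (Fin 3 → Fin 3 → F))
  haveI : LocallyCompactSpace (Matrix (Fin 3) (Fin 3) F) := locallyCompactSpace_matrix (F := F) (m := Fin 3) (n := Fin 3)
  haveI : SecondCountableTopology (Matrix (Fin 3) (Fin 3) F) := secondCountableTopology_matrix (F := F) (m := Fin 3) (n := Fin 3)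
  haveI : μ𝔤.Regular := regular_of_isAddHaarMeasure (F := F) μ𝔤
  -- ===== the strict derivative and the scaling equivalence (§2) =====
  obtain ⟨e, he, -, hderiv⟩ := hasStrictFDerivAt_orbitChart (K := F) d hd
  rw [← hΨ] at hderiv
  have hc : ∀ i j : Fin 3, (if i = j then (1 : F) else d j - d i) ≠ 0 := by
    intro i j
    split_ifs with h
    · exact one_ne_zero
    · exact sub_ne_zero.2 (hd j i (Ne.symm h))
  have hchar : addEquivAddHaarChar e.toContinuousAddEquiv = normAbs F (∏ i : Fin 3, ∏ j : Fin 3, if i = j then (1 : F) else d j - d i) :=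
    addEquivAddHaarChar_scaling _ hc e he
  have hchar0 : normAbs F (∏ i : Fin 3, ∏ j : Fin 3, if i = j then (1 : F) else d j - d i) ≠ 0 :=
    (map_ne_zero _).2 (Finset.prod_ne_zero_iff.2 fun i _ => Finset.prod_ne_zero_iff.2 fun j _ => hc i j)
  -- ===== the ball filtration `Λ_j = closedBall 0 ‖ϖ‖^j = M₃(𝔭^j)` =====
  obtain ⟨ϖ, hϖ0, hϖ⟩ := exists_normAbs_eq_inv (F := F)
  have hγ0 : 0 < ‖ϖ‖ := norm_pos_iff.2 hϖ0
  have hγ1 : ‖ϖ‖ < 1 := by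
    rw [IsNonarchimedeanLocalField.norm_lt_one_iff, ← normAbs_lt_one_iff, hϖ]
    exact inv_lt_one_of_one_lt₀ (by exact_mod_cast one_lt_residueFieldCard F)
  obtain ⟨Λ, hΛ⟩ := Literature.Analysis.Calculus.exists_addSubgroup_coe_eq_closedBall (V := Matrix (Fin 3) (Fin 3) F) one_pos hγ0
  have hbox : ∀ k : ℕ, (Λ k : Set (Matrix (Fin 3) (Fin 3) F)) = {X : Matrix (Fin 3) (Fin 3) F | ∀ i j, X i j ∈ primePowBall F k} := by
    intro k
    rw [hΛ k, one_mul]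
    ext X
    rw [mem_closedBall_zero_iff, Matrix.norm_le_iff (pow_nonneg hγ0.le k), Set.mem_setOf_eq]
    refine forall_congr' fun i => forall_congr' fun j => ?_
    rw [← norm_pow, IsNonarchimedeanLocalField.norm_le_norm_iff_vle, Valuation.Compatible.vle_iff_le (v := ValuativeRel.valuation F),
      ← normAbs_le_normAbs_iff, map_pow, hϖ, primePowBall, Set.mem_setOf_eq, zpow_natCast]
  -- ===== the depth chart (★ `exists_depth_chart`) =====
  -- Borel instances for the normed (defeq) topologies are passed explicitly (★ HC-D pattern)
  obtain ⟨k₀, hk⟩ := @exists_depth_chart F _ (Matrix (Fin 3) (Fin 3) F) _ _ _ _ _ ‹BorelSpace (Matrix (Fin 3) (Fin 3) F)›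
    (Matrix (Fin 3) (Fin 3) F) _ _ _ ‹BorelSpace (Matrix (Fin 3) (Fin 3) F)› μ𝔤 ‹μ𝔤.IsAddHaarMeasure›.toIsFiniteMeasureOnCompacts
    ‹μ𝔤.IsAddHaarMeasure›.toIsAddLeftInvariant Ψ 0 e hderiv Λ 1 ‖ϖ‖ hΛ one_pos hγ0 hγ1
  refine ⟨k₀, fun k hkk => ?_⟩
  obtain ⟨hinj, himg, hmap, hlin⟩ := hk k hkk
  have hΨ0 : Ψ 0 = Matrix.diagonal d := by rw [hΨ]; exact orbitChart_zero d
  have himg' : Ψ '' {X : Matrix (Fin 3) (Fin 3) F | ∀ i j, X i j ∈ primePowBall F k} =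
      Matrix.diagonal d +ᵥ ((e : Matrix (Fin 3) (Fin 3) F → Matrix (Fin 3) (Fin 3) F) '' {X : Matrix (Fin 3) (Fin 3) F | ∀ i j, X i j ∈ primePowBall F k}) := by
    have h := himg k le_rfl 0 (Λ k).zero_mem
    rwa [add_zero, zero_vadd, hΨ0, hbox k] at h
  have hboxopen : IsOpen {X : Matrix (Fin 3) (Fin 3) F | ∀ i j, X i j ∈ primePowBall F k} :=
    Literature.MeasureTheory.Group.isOpen_setOf_forall_mem_primePowBall (F := F) (n := Fin 3) k
  have hboxcpt : IsCompact {X : Matrix (Fin 3) (Fin 3) F | ∀ i j, X i j ∈ primePowBall F k} :=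
    Literature.MeasureTheory.Group.isCompact_setOf_forall_mem_primePowBall (F := F) (n := Fin 3) k
  have hboxm : MeasurableSet {X : Matrix (Fin 3) (Fin 3) F | ∀ i j, X i j ∈ primePowBall F k} := hboxopen.measurableSet
  have hΨc : Continuous Ψ := by rw [hΨ]; exact continuous_orbitChart d
  refine ⟨?_, ?_, hboxcpt.image hΨc, ⟨0, fun i j => zero_mem_primePowBall _, hΨ0⟩, fun h hm => ?_⟩
  · -- (a) injectivity
    have h1 := hinj
    rwa [zero_vadd, hbox k] at h1
  · -- (b) openness: `V_k = t + e(Λ_k)`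
    rw [himg', ← Set.image_vadd]
    exact (Homeomorph.addLeft (Matrix.diagonal d)).isOpenMap _ (e.toHomeomorph.isOpenMap _ hboxopen)
  · -- (c) Haar-exactness
    set S : Set (Matrix (Fin 3) (Fin 3) F) := {X : Matrix (Fin 3) (Fin 3) F | ∀ i j, X i j ∈ primePowBall F k} with hS
    -- ★'s identity, re-read in this context (definitional)
    have h1 : ∫⁻ v in S, h (Ψ v) ∂μ𝔤 = ∫⁻ v in S, h (Matrix.diagonal d + e v) ∂μ𝔤 := by
      have h0 := hlin h hm
      simp only [zero_add, hΨ0, hbox k] at h0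
      exact h0
    rw [h1]
    have heS : MeasurableSet ((e : Matrix (Fin 3) (Fin 3) F → Matrix (Fin 3) (Fin 3) F) '' S) :=
      (e.toHomeomorph.isOpenMap _ hboxopen).measurableSet
    have hmeas_g : Measurable fun Y : Matrix (Fin 3) (Fin 3) F => h (Matrix.diagonal d + Y) := hm.comp (measurable_const_add _)
    -- `∫⁻_S h(t + e v) = ∫⁻ (e S).indicator (h(t + ·)) ∘ e`
    have hstep1 : ∫⁻ v in S, h (Matrix.diagonal d + e v) ∂μ𝔤 =
        ∫⁻ v, ((e : Matrix (Fin 3) (Fin 3) F → Matrix (Fin 3) (Fin 3) F) '' S).indicator (fun Y => h (Matrix.diagonal d + Y)) (e v) ∂μ𝔤 := by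
      rw [← lintegral_indicator hboxm]
      refine lintegral_congr fun v => ?_
      by_cases hv : v ∈ S
      · rw [Set.indicator_of_mem hv, Set.indicator_of_mem (e.injective.mem_set_image.2 hv)]
      · rw [Set.indicator_of_notMem hv, Set.indicator_of_notMem (fun h' => hv (e.injective.mem_set_image.1 h'))]
    -- the Haar character of `e`
    have hstep2 : ∫⁻ v, ((e : Matrix (Fin 3) (Fin 3) F → Matrix (Fin 3) (Fin 3) F) '' S).indicator (fun Y => h (Matrix.diagonal d + Y)) (e v) ∂μ𝔤 =
        ((normAbs F (∏ i : Fin 3, ∏ j : Fin 3, if i = j then (1 : F) else d j - d i))⁻¹ : ℝ≥0) *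
          ∫⁻ Y, ((e : Matrix (Fin 3) (Fin 3) F → Matrix (Fin 3) (Fin 3) F) '' S).indicator (fun Y => h (Matrix.diagonal d + Y)) Y ∂μ𝔤 := by
      rw [← lintegral_map (hmeas_g.indicator heS) e.continuous.measurable]
      have hmapμ : μ𝔤.map (e : Matrix (Fin 3) (Fin 3) F → Matrix (Fin 3) (Fin 3) F) = (addEquivAddHaarChar e.toContinuousAddEquiv)⁻¹ • μ𝔤 := by
        rw [← ContinuousLinearEquiv.toContinuousAddEquiv_coe]
        exact Literature.MeasureTheory.Group.map_eq_addEquivAddHaarChar_inv_smul μ𝔤 e.toContinuousAddEquiv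
      rw [hmapμ, lintegral_smul_measure, hchar, ENNReal.smul_def, smul_eq_mul]
    -- translation by `t` and `V_k = t + e S`
    have hVm : MeasurableSet (Matrix.diagonal d +ᵥ ((e : Matrix (Fin 3) (Fin 3) F → Matrix (Fin 3) (Fin 3) F) '' S)) := heS.const_vadd _
    have hstep3 : ∫⁻ Y, ((e : Matrix (Fin 3) (Fin 3) F → Matrix (Fin 3) (Fin 3) F) '' S).indicator (fun Y => h (Matrix.diagonal d + Y)) Y ∂μ𝔤 =
        ∫⁻ Y in Ψ '' S, h Y ∂μ𝔤 := by
      rw [himg', ← lintegral_indicator hVm,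
        ← lintegral_add_left_eq_self (μ := μ𝔤)
          ((Matrix.diagonal d +ᵥ ((e : Matrix (Fin 3) (Fin 3) F → Matrix (Fin 3) (Fin 3) F) '' S)).indicator h) (Matrix.diagonal d)]
      refine lintegral_congr fun Y => ?_
      by_cases hY : Y ∈ (e : Matrix (Fin 3) (Fin 3) F → Matrix (Fin 3) (Fin 3) F) '' S
      · rw [Set.indicator_of_mem hY, Set.indicator_of_mem]
        exact Set.vadd_mem_vadd_set_iff.2 hY
      · rw [Set.indicator_of_notMem hY, Set.indicator_of_notMem]
        exact fun h' => hY (Set.vadd_mem_vadd_set_iff.1 h')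
    rw [hstep1, hstep2, hstep3]

end LocalField

end Summit.HodgeConjecture.HodgeConjecture.Cruxes.H413.K2E3GL3RegularDiagonalOrbitChart

end
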